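import Summits.HodgeConjecture.HodgeConjecture.Theses.HeckePrymWeil
import Summits.HodgeConjecture.HodgeConjecture.Theorems.HeckePrymWeilWeilTenfoldsSqrtMinus11OfSecantSpread
import Summits.HodgeConjecture.HodgeConjecture.Theorems.HeckePrymWeilIsoInvariance
import Literature.AlgebraicGeometry.HodgeTheory.AbsoluteHodgeClasses
import Literature.AlgebraicGeometry.Motives.FamiliesVHS
import Literature.AlgebraicGeometry.Motives.BaseChange
import HarnessLib
import HarnessLib.Audit

/-!
# Line `toric-cusp-k-lift` — crux `HeckePrymWeil.WeilTenfoldsSqrtMinus11` (stmt-HodgeConjecture-1262)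

Crux-strategist r1 (`planner-cstrat-stmt-HodgeConjecture-1262-r1-0`, 2026-08-17; REDIRECT second opinion after
census s1).  A line of a DIFFERENT SHAPE from every line this crux has had (interior anchor + semiregular
object + Perry/Buchweitz–Flenner spreading): the anchor is a TOTALLY TORIC ℚ̄-CUSP of the split `ℚ(√-11)`
twelvefold component, where the "object" is free (a `K₀`-class: every weight-`2p` Hodge cycle on a ℚ̄-Tate snc
fibre lifts to `K`-theory — `Ext²` of mixed Tate motives over a number field vanishes, Borel), and the
transport is the SIDEWAYS DEFORMATION of that `K₀`-class off the snc fibre along a curve of the Hodge locus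
(log form of Bloch–Esnault–Kerz + algebraization), NOT the semiregularity of a sheaf at an interior point.

Why this line is now admissible for THIS crux (the lever is the route's own): totally toric cusps exist
exactly on HYPERBOLIC components (`disc = (-1)ⁿ`, Witt index `n`; Meyer + Landherr) — which is why the cusp
routes (`TropicalCuspLift`, retired; `TateCuspKLift`, open) never served the non-hyperbolic components of
this crux.  Since 2026-08-17 `AimedDescending` is PROVED (`Theorems.aimedDescending_proof`), and with it
`weilTenfoldsSqrtMinus11_of_splitTwelvefolds` (Theorems, p154022 chain): the crux follows from the SPLIT
`√-11` TWELVEFOLD component alone, which HAS totally toric ℚ̄-cusps.  So: hyperbolic-only cusp engine +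
aimed descent = every discriminant in dimension 10.

## Registered stubs (the only `sorry`s)
* `stub_toricCuspReach` (REACH, theorem-grade infrastructure, XL): every split `√-11` twelvefold is a fibre of a
  smooth projective family over a smooth projective CURVE with a non-empty ℚ̄-Tate fibre (the Mumford /
  Faltings–Chai / Künnemann semistable model over a curve of the neat-level PEL Shimura variety through a
  0-dimensional cusp, the cusp fibre taken at a ℚ̄-point of the boundary), carrying an ABSOLUTE HODGE class
  on the total space that restricts to the given Weil class (global invariant cycles + André's semisimplicity
  of motivated motives; Weil classes are motivated, André 1996 Thm 0.6.2; motivated ⇒ absolute Hodge).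
* `stub_toricFibreRestrictionPulledBack` (K1: the restriction of an absolute Hodge class to a non-empty
  ℚ̄-Tate fibre is a pulled-back-algebraic = `ch`-of-`K₀` class) — the REPAIRED (non-vacuous: `Nonempty ι`)
  form of `TateCuspKLift.ArithmeticTateRestriction` (stmt-9313); shared staffing recommended.
* `stub_kClassSpreadsOffToricFibre` (K2, HARDEST: a rational `(p,p)` class on the smooth projective total
  space whose restriction to the non-empty ℚ̄-Tate fibre is pulled-back-algebraic is algebraic on every
  smooth projective fibre) — the REPAIRED form of `TateCuspKLift.KClassPropagates` (stmt-9314): log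
  Bloch–Esnault–Kerz + algebraization; OPEN mathematics (HC-implied, so unfalsifiable short of ¬HC, Disproof F1).

PROVED here: `splitTwelvefolds_of_stubs` (the three stubs give every split `√-11` twelvefold, route typing:
reach, K1 at the cusp fibre, K2 to the target fibre, `map_mem_algebraicClasses_of_iso` back to `A`) and the
composition `WeilTenfoldsSqrtMinus11_of` BY NAME through the landed
`Theorems.WeilTenfoldsSqrtMinus11.SecantSpread.weilTenfoldsSqrtMinus11_of_splitTwelvefolds`.

## Disproof used (`Cruxes/WeilTenfoldsSqrtMinus11/Disproof.lean`, cycle 3, re-read 2026-08-17T14:4xZ)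
F1/F9: K1 and K2 are HC-consequences (refutable only by ¬HC); the reach stub is a theorem (HC-independent).
§B `hhodge`/`hrat` load-bearing — honoured: the reach stub consumes the rational `(6,6)` Weil class `c` and
returns an absolute Hodge extension; K2 consumes `IsRationalClass ∧ IsOfHodgeType`.  SCOPE "every δ" —
honoured by `AimedDescending` (proved).  `SplitObjectsNoGo.md` (split objects never semiregular with Weil
charge) does not bite: no semiregular object is posited anywhere.  `ledger negatives` (3 entries): unrelated.
-/

noncomputable section

-- single-problem summit (Problem = Summit): the mandated namespace repeats `HodgeConjecture`.
set_option linter.dupNamespace false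

open CategoryTheory
open Literature.AlgebraicGeometry Literature.AlgebraicGeometry.Motives
  Literature.AlgebraicGeometry.HodgeTheory
open Summit.HodgeConjecture.HodgeConjecture.Theses.HeckePrymWeil

namespace Summit.HodgeConjecture.HodgeConjecture.Cruxes.WeilTenfoldsSqrtMinus11.ToricCuspKLift

/-! ## §0 Vocabulary: non-empty ℚ̄-Tate fibres and pulled-back-algebraic classes -/

/-- **A non-empty ℚ̄-Tate fibre.**  The scheme-theoretic fibre `X_o = f⁻¹(o)` is (isomorphic over `ℂ` to the
base change along some `σ : ℚ̄ → ℂ` of) a ℚ̄-scheme admitting a finite partition, indexed by a NON-EMPTY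
type, into locally closed split tori `𝔾_m^{b i}` — verbatim the clause of `TateCuspKLift.CuspAccessibleHodge`
plus `Nonempty ι`, which excludes the vacuous witness `X_o = ∅` flagged by five refuters on stmt-9312/9313/9314
(a non-empty torus maps to `X₁`, so `X₁ ≠ ∅`).  Fibres at 0-dimensional toroidal cusps of neat-level PEL
Shimura varieties taken at ℚ̄-points of the boundary qualify (unions of toric varieties glued along
torus-invariant strata).  [cite: FaltingsChai1990, Ch. III §§8–10 and Ch. VI §1] -/
def IsNonemptyQbarTateFibre {𝒳 C : SchemeOver ℂ} (f : 𝒳 ⟶ C) (o : ComplexPoints C) : Prop :=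
  ∃ (X₁ : SchemeOver (AlgebraicClosure ℚ)) (σ : AlgebraicClosure ℚ →+* ℂ)
    (_ : fiberOver f o ≅ (baseChangeHom σ).obj X₁) (ι : Type) (_ : Finite ι) (_ : Nonempty ι) (b : ι → ℕ)
    (e : ∀ i : ι, specOver (AlgebraicClosure ℚ) (AddMonoidAlgebra (AlgebraicClosure ℚ) (Fin (b i) →₀ ℤ)) ⟶ X₁),
    (∀ i, AlgebraicGeometry.IsImmersion (e i).left) ∧
    (Pairwise fun i j => Disjoint (Set.range fun x => (e i).left.base x) (Set.range fun x => (e j).left.base x)) ∧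
    (⋃ i, Set.range fun x => (e i).left.base x) = Set.univ

/-- **Pulled-back-algebraic classes** `PB^p(X₀)`: the ℂ-span of pull-backs `g^*a` of algebraic classes along
ℂ-morphisms `g : X₀ → Y` to smooth projective `Y` ( = `ch_p(K₀(X₀) ⊗ ℚ) ⊗ ℂ` for quasi-projective `X₀`:
Grassmannian pull-backs one way, Grothendieck–Riemann–Roch the other) — verbatim the rendering of
`TateCuspKLift.ArithmeticTateRestriction`. [cite: Arapura2016SingularLefschetz, §8 Lemma 8.6] -/
def pulledBackAlgebraic (X₀ : SchemeOver ℂ) (p : ℕ) : Submodule ℂ (complexBetti X₀ (2 * p)) :=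
  Submodule.span ℂ {c : complexBetti X₀ (2 * p) | ∃ (m : ℕ) (Y : SchemeOver ℂ) (_ : IsSmoothProjective m Y)
    (g : X₀ ⟶ Y) (a : complexBetti Y (2 * p)), a ∈ algebraicClasses Y p ∧ c = complexBetti.map g (2 * p) a}

/-! ## §1 The registered stubs -/

/-- **Stub R_cusp — TORIC CUSP REACH (theorem-grade infrastructure).**  For every SPLIT `ℚ(√-11)`-Weil abelian
twelvefold `(A, φ)` — hyperbolic for the `K`-symmetrised hyperplane class `h = 11·e^*a + φ^*e^*a` of a projective
embedding, the route typing of `AimedDescending` — and every non-zero rational `(6,6)`-class `c` of its typed Weil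
plane, there are: a smooth projective `13`-fold `𝒳`, a smooth projective curve `C`, a morphism `f : 𝒳 → C`, a
point `o` whose fibre is NON-EMPTY ℚ̄-TATE, a point `t` whose fibre is smooth projective of dimension `12` and
identified with `A` by an isomorphism `ι : A.X ≅ X_t`, and an ABSOLUTE HODGE class `ξ ∈ H¹²(𝒳(ℂ);ℂ)` with
`ι^*(ξ|X_t) = c`.  Intended proof: (i) `(H₁(A,ℤ), E_h, φ_*)` is a hyperbolic hermitian `ℤ[√-11]`-lattice, so the
neat-level PEL Shimura variety `S` of its isometry class (Baily–Borel, quasi-projective over ℚ̄) has `A ≅ 𝒜_s`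
for a complex point `s` of its universal family and has 0-DIMENSIONAL cusps (Witt index 6); (ii) a complex curve
in `S̄` through `s` and a ℚ̄-point `o` of the toroidal boundary over such a cusp, the pulled-back family, and the
Mumford–Faltings–Chai–Künnemann semistable projective REGULAR model over (a finite cover of) its normalisation:
total space smooth projective, fibre at `o` a union of toric varieties glued along toric strata, defined over
ℚ̄ because the degeneration datum is the ℚ̄-point `o`; (iii) neat level kills the `det`-monodromy on
`⋀¹²_K R¹f_*ℚ`, so `c` extends to a flat section, hence (global invariant cycles, Deligne 1971 4.1.1) to a class
on `𝒳`, which can be chosen MOTIVATED (Weil classes are motivated, André 1996 Thm 0.6.2; motivated motives form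
a semisimple abelian category, so `i_t^*` splits motivatedly) and is therefore absolute Hodge (André 1996 §0.6;
Deligne 1982 for abelian fibres).  HC-independent; fails only by typing.  Lean size XL (no Shimura varieties,
toroidal compactifications or motivated-cycle calculus on real carriers).
[cite: FaltingsChai1990, Ch. VI §1 and Ch. III §10] [cite: Andre1996Motifs, Thm. 0.5, Thm. 0.6.2]
[cite: Deligne1982HodgeCycles, Thm. 2.11] [cite: vanGeemen1994HodgeAV, 5.2–5.4] -/
theorem stub_toricCuspReach :
    ∀ (A : AbelianVariety ℂ) (φ : A ⟶ A), A.dim = 12 → φ ≫ φ = -((11 : ℤ) • 𝟙 A) →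
      ∀ (e : ProjectiveEmbedding A.X) (a : complexBetti (projectiveSpace e.n ℂ) 2),
        IsRationalClass a → a ≠ 0 →
        IsHyperbolicWeilType A φ 6
          ((11 : ℂ) • complexBetti.map e.ι 2 a + complexBetti.map φ.hom.hom.hom 2 (complexBetti.map e.ι 2 a)) →
        ∀ c : complexBetti A.X (2 * 6), IsRationalClass c → IsOfHodgeType 12 A.X (2 * 6) 6 6 c →
          c ∈ Module.End.eigenspace (complexBetti.map (𝟙 A + φ).hom.hom.hom (2 * 6)).hom
                ((1 + Complex.I * (Real.sqrt (11 : ℝ) : ℂ)) ^ 12) ⊔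
              Module.End.eigenspace (complexBetti.map (𝟙 A + φ).hom.hom.hom (2 * 6)).hom
                ((1 - Complex.I * (Real.sqrt (11 : ℝ) : ℂ)) ^ 12) →
          c ≠ 0 →
          ∃ (𝒳 C : SchemeOver ℂ) (f : 𝒳 ⟶ C) (o t : ComplexPoints C) (ι : A.X ≅ fiberOver f t)
            (ξ : complexBetti 𝒳 (2 * 6)),
            IsSmoothProjective 13 𝒳 ∧ IsSmoothProjective 1 C ∧ IsNonemptyQbarTateFibre f o ∧
            IsSmoothProjective 12 (fiberOver f t) ∧ IsAbsoluteHodgeClass 13 𝒳 6 ξ ∧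
            complexBetti.map ι.hom (2 * 6) (complexBetti.map (fiberι f t) (2 * 6) ξ) = c := by
  sorry

/-- **Stub K1 — RESTRICTION TO A NON-EMPTY ℚ̄-TATE FIBRE IS PULLED-BACK-ALGEBRAIC** (repaired form of
`TateCuspKLift.ArithmeticTateRestriction`, stmt-9313: `Nonempty ι` added; any `f`, since `𝒳` is irreducible).
For `𝒳` smooth projective of dimension `N`, `C` a smooth projective curve, `f : 𝒳 → C`, `o` with non-empty
ℚ̄-Tate fibre and `ξ ∈ H²ᵖ(𝒳(ℂ);ℂ)` ABSOLUTE HODGE: `ξ|X_o ∈ PB^p(X_o)`.  Intended proof (TateCuspKLift card (G)):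
`ξ|X_o ∈ Hom_MHS(ℚ(−p), H²ᵖ(X_o))` is the image of a pure weight-`2p` structure; `X_o ≅ X₁ ⊗_σ ℂ`, `X₁`
torus-partitioned over a number field `F`, so `M(X₁) ∈ DMT(F)`; `Ext²_{MT(F)} = 0` gives
`H²ᵖ_M(X₁, ℚ(p)) ↠ Hom_{MT(F)}(ℚ(−p), h²ᵖ(X₁))`; the `Ext¹`-obstructions of the weight dévissage have vanishing
Hodge realisation at EVERY complex place because each conjugate `ξ^{σ'}` is again Hodge (absolute Hodge), and
Borel's regulator is injective on `⊕_places`; finally `K₀ ⊗ ℚ ↠ KH₀ ⊗ ℚ` in Adams weight `p` for snc toric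
unions (CHWW / Anderson–Payne for one toric variety).  HC-implied (`Y := 𝒳`, `g := fiberι f o`), so no
refutation short of ¬HC; why it might fail as a MECHANISM: an `Ext¹` step not `F`-rational, or `K₀ → KH₀` not
onto for the glued union.  [cite: DeligneGoncharov2005, §§1–2] [cite: Borel1977, Thm. 11.2]
[cite: Arapura2016SingularLefschetz, Conj. 8.1, Lemma 8.6, Prop. 8.3] -/
theorem stub_toricFibreRestrictionPulledBack :
    ∀ (N p : ℕ) (𝒳 C : SchemeOver ℂ) (f : 𝒳 ⟶ C) (o : ComplexPoints C),
      IsSmoothProjective N 𝒳 → IsSmoothProjective 1 C → IsNonemptyQbarTateFibre f o →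
      ∀ ξ : complexBetti 𝒳 (2 * p), IsAbsoluteHodgeClass N 𝒳 p ξ →
        complexBetti.map (fiberι f o) (2 * p) ξ ∈ pulledBackAlgebraic (fiberOver f o) p := by
  sorry

/-- **Stub K2 — A `K`-CLASS ON THE TORIC FIBRE SPREADS SIDEWAYS (HARDEST; the bet)** (repaired form of
`TateCuspKLift.KClassPropagates`, stmt-9314: `Nonempty ι` added, so the constant-map / empty-fibre witnesses
that made the original ⟺ HC are gone; with `𝒳` irreducible `f` is constant onto `o` — trivial case — or flat
and surjective).  For `𝒳`, `C`, `f`, `o` as in K1 and `ξ ∈ H²ᵖ(𝒳(ℂ);ℂ)` rational of Hodge type `(p,p)`: IF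
`ξ|X_o ∈ PB^p(X_o)` (a `K₀(X_o) ⊗ ℚ`-class) THEN `ξ|X_t` is algebraic on every smooth projective fibre `X_t`.
Mechanism: represent the `K₀`-class by perfect complexes on the snc toric fibre, deform over the formal (log)
germ of `C` at `o` — log Bloch–Esnault–Kerz: the obstruction is the Hodge obstruction, zero since `ξ` is
globally `(p,p)` —, algebraize (`𝒳` projective over `C`; BEK Question 5 / Conj. 4 is the smooth-fibre shape of
this step), read `ch_p = ξ|X_t` near `o`, spread along `C` (relative Chow, countability).  OPEN mathematics:
contains the deformational Hodge conjecture for torus-degenerate families (e.g. Dwork-type pencils with flat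
Fermat Hodge classes, large-complex-structure limits); HC-implied, unfalsifiable short of ¬HC.  Why it might
fail as a line: log-BEK is not in print; BEK's char-0 algebraization counterexample (App. A) shows
`K₀(𝒳̂) → lim K₀(X_n)` is not onto in general, so the lift must be steered (Adams eigenspaces / Fourier–Mukai
symmetry on abelian fibres).  [cite: BlochEsnaultKerz2014CharZero, Thm. 1, Conj. 4, Question 5, Prop. 31]
[cite: FaltingsChai1990, Ch. III §10] [cite: Bloch1972Semiregularity, Thm. 7.1] -/
theorem stub_kClassSpreadsOffToricFibre :
    ∀ (N p : ℕ) (𝒳 C : SchemeOver ℂ) (f : 𝒳 ⟶ C) (o : ComplexPoints C),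
      IsSmoothProjective N 𝒳 → IsSmoothProjective 1 C → IsNonemptyQbarTateFibre f o →
      ∀ ξ : complexBetti 𝒳 (2 * p), IsRationalClass ξ → IsOfHodgeType N 𝒳 (2 * p) p p ξ →
        complexBetti.map (fiberι f o) (2 * p) ξ ∈ pulledBackAlgebraic (fiberOver f o) p →
        ∀ (t : ComplexPoints C) (n : ℕ), IsSmoothProjective n (fiberOver f t) →
          complexBetti.map (fiberι f t) (2 * p) ξ ∈ algebraicClasses (fiberOver f t) p := by
  sorry

/-! ### Name-keyed aliases (hypotheses of the composition BY NAME) -/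
namespace Registered

/-- Alias of the statement of `stub_toricCuspReach`. -/
abbrev stub_toricCuspReach : Prop :=
  type_of% _root_.Summit.HodgeConjecture.HodgeConjecture.Cruxes.WeilTenfoldsSqrtMinus11.ToricCuspKLift.stub_toricCuspReach
/-- Alias of the statement of `stub_toricFibreRestrictionPulledBack`. -/
abbrev stub_toricFibreRestrictionPulledBack : Prop :=
  type_of% _root_.Summit.HodgeConjecture.HodgeConjecture.Cruxes.WeilTenfoldsSqrtMinus11.ToricCuspKLift.stub_toricFibreRestrictionPulledBack
/-- Alias of the statement of `stub_kClassSpreadsOffToricFibre`. -/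
abbrev stub_kClassSpreadsOffToricFibre : Prop :=
  type_of% _root_.Summit.HodgeConjecture.HodgeConjecture.Cruxes.WeilTenfoldsSqrtMinus11.ToricCuspKLift.stub_kClassSpreadsOffToricFibre

end Registered

/-! ## §2 The cusp bridge (PROVED): the three stubs give every split `√-11` twelvefold -/

/-- **Cusp bridge.**  `R_cusp → K1 → K2 →` the Hodge–Weil classes of EVERY split `ℚ(√-11)` twelvefold are
algebraic (route typing = the hypothesis of `AimedDescending` at `(11, 5)`, `m = 6`).  Proof: `c = 0` is
algebraic (submodule); otherwise the reach stub gives `(𝒳, C, f, o, t, ι, ξ)`; K1 puts `ξ|X_o` in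
`PB⁶(X_o)` (`ξ` absolute Hodge); K2 makes `ξ|X_t` algebraic on the smooth projective fibre `X_t` (`ξ` is
rational of type `(6,6)` as an absolute Hodge class); `map_mem_algebraicClasses_of_iso ι` carries it to `A`,
where it is `c` (`Theorems.map_mem_algebraicClasses_of_iso`, landed with `isoInvariance_proof`). [folklore] -/
theorem splitTwelvefolds_of_stubs (hR : Registered.stub_toricCuspReach)
    (hK1 : Registered.stub_toricFibreRestrictionPulledBack) (hK2 : Registered.stub_kClassSpreadsOffToricFibre) :
    ∀ (A : AbelianVariety ℂ) (φ : A ⟶ A), A.dim = 12 → φ ≫ φ = -((11 : ℤ) • 𝟙 A) →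
      ∀ (e : ProjectiveEmbedding A.X) (a : complexBetti (projectiveSpace e.n ℂ) 2),
        IsRationalClass a → a ≠ 0 →
        IsHyperbolicWeilType A φ 6
          ((11 : ℂ) • complexBetti.map e.ι 2 a + complexBetti.map φ.hom.hom.hom 2 (complexBetti.map e.ι 2 a)) →
        ∀ c : complexBetti A.X 12, IsRationalClass c → IsOfHodgeType 12 A.X 12 6 6 c →
          c ∈ Module.End.eigenspace (complexBetti.map (𝟙 A + φ).hom.hom.hom 12).hom
                ((1 + Complex.I * (Real.sqrt (11 : ℝ) : ℂ)) ^ 12) ⊔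
              Module.End.eigenspace (complexBetti.map (𝟙 A + φ).hom.hom.hom 12).hom
                ((1 - Complex.I * (Real.sqrt (11 : ℝ) : ℂ)) ^ 12) →
          c ∈ algebraicClasses A.X 6 := by
  intro A φ hdim hφ e a ha ha0 hhyp c hc hH hW
  by_cases hc0 : c = 0
  · subst hc0
    exact Submodule.zero_mem _
  obtain ⟨𝒳, C, f, o, t, ι, ξ, h𝒳, hC, ho, ht, hξ, hιc⟩ :=
    hR A φ hdim hφ e a ha ha0 hhyp c hc hH hW hc0
  have hPB : complexBetti.map (fiberι f o) (2 * 6) ξ ∈ pulledBackAlgebraic (fiberOver f o) 6 :=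
    hK1 13 6 𝒳 C f o h𝒳 hC ho ξ hξ
  have halg : complexBetti.map (fiberι f t) (2 * 6) ξ ∈ algebraicClasses (fiberOver f t) 6 :=
    hK2 13 6 𝒳 C f o h𝒳 hC ho ξ hξ.isRationalClass hξ.isOfHodgeType hPB t 12 ht
  have hA : complexBetti.map ι.hom (2 * 6) (complexBetti.map (fiberι f t) (2 * 6) ξ) ∈ algebraicClasses A.X 6 :=
    Summit.HodgeConjecture.HodgeConjecture.Theorems.map_mem_algebraicClasses_of_iso ι halg
  rw [hιc] at hA
  exact hA

/-! ## §3 The composition: `WeilTenfoldsSqrtMinus11` from the three stubs, BY NAME -/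

/-- **`WeilTenfoldsSqrtMinus11` from the three stubs**: the cusp bridge gives the split `√-11` twelvefolds, and
the landed `weilTenfoldsSqrtMinus11_of_splitTwelvefolds` (`Theorems.aimedDescending_proof` at `(11,5)`) gives
every `ℚ(√-11)` tenfold — the crux BY NAME. [cite: Markman2025SurveySecant, §11.5 Step 2] -/
theorem WeilTenfoldsSqrtMinus11_of (hR : Registered.stub_toricCuspReach)
    (hK1 : Registered.stub_toricFibreRestrictionPulledBack) (hK2 : Registered.stub_kClassSpreadsOffToricFibre) :
    Summit.HodgeConjecture.HodgeConjecture.Theses.HeckePrymWeil.WeilTenfoldsSqrtMinus11 :=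
  Summit.HodgeConjecture.HodgeConjecture.Theorems.WeilTenfoldsSqrtMinus11.SecantSpread.weilTenfoldsSqrtMinus11_of_splitTwelvefolds
    (splitTwelvefolds_of_stubs hR hK1 hK2)

/-- The same, fed by the stubs themselves (so the only `sorry`s of the file are the three stubs). [folklore] -/
theorem WeilTenfoldsSqrtMinus11_of_stubs :
    Summit.HodgeConjecture.HodgeConjecture.Theses.HeckePrymWeil.WeilTenfoldsSqrtMinus11 :=
  WeilTenfoldsSqrtMinus11_of stub_toricCuspReach stub_toricFibreRestrictionPulledBack
    stub_kClassSpreadsOffToricFibre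

end Summit.HodgeConjecture.HodgeConjecture.Cruxes.WeilTenfoldsSqrtMinus11.ToricCuspKLift

end
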